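import Literature.Analysis.FluidPDE.PassiveVectorTensorEnergyEquality
import Literature.Analysis.FluidPDE.PassiveVectorTensorPropagatorEnergy
import Literature.Analysis.FluidPDE.PassiveVectorTensorPropagatorBandKill
import Literature.Analysis.FluidPDE.PassiveScalarForcedTrace
import HarnessLib

/-!
# The energy EQUALITY for the two-parameter propagator of the constant-tensor passive-vector problem, at EVERY time

Analysis/FluidPDE file (everything proved; no definitions, no named facts). For a propagator
`Torus.IsPropagator T b 𝔸 U` (`PassiveVectorTensorPropagator`) of `∂ₜw + (b·∇)w + ∇π = ∇·(𝔸∇w)`, `∇·w = 0`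
with `NearIso 𝔸 lo hi`, `lo > 0`, `b ∈ L^∞((0,T) × T^d)` weakly divergence free for a.e. `t`, a base time
`s ∈ [0,T)` and a weakly divergence-free datum `y ∈ L²`:

* `IsPropagator.exists_norm_sq_eq` — there are a weak solution `w` on the window `(0, T − s)` from `y` along
  the shifted carrier and its weak space gradient `G ∈ L²(μ_{T−s})` such that **for EVERY `t ∈ [s,T)`**
  `‖U s t y‖² = ‖y‖² − 2 ∫_{(0,t−s]} ∫ Σ_{l,i,c,e} 𝔸_{icle} (G τ c)_i (G τ e)_l`
  (the energy EQUALITY of the window maps; Lions–Magenes 1972, Chap. 3 §4.4 (4.20); Temam 1984, Ch. III §1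
  Lemma 1.2 / Thm. 1.1).
  Proof: the a.e.-in-time equality of `PassiveVectorTensorEnergyEquality` for the window solution, transported
  to `U` by the field `repr`; at a fixed `t` the two inequalities follow from the contraction + cocycle
  (`‖U s t' y‖ ≤ ‖U s t y‖` for `t' > t`, right limit of the continuous right side) and from the weak continuity
  of `t' ↦ U s t' y` tested against `U s t y` (lower semicontinuity of the norm), both through
  `le_on_Icc_of_ae_le_of_continuousOn₂`.

Cell `ad-ideate`, K1L_D, lead memo L14 / tenure 05:03:34Z item L6 (a) (energy equality on coarse windows
`[s₀,s₁]`: `‖x‖² − ‖Um s₀ s₁ x‖² = 2∫⟨𝔸∇w,∇w⟩`).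

## References

* J.-L. Lions, E. Magenes, *Non-homogeneous boundary value problems and applications* I (1972), Chap. 3 §4.4. [`LionsMagenes1972`]
* R. Temam, *Navier–Stokes Equations*, 3rd ed. (1984), Ch. III §1, Lemma 1.2, Thm. 1.1, Lemma 1.4. [`Temam1984`]
* A. Pazy, *Semigroups of Linear Operators and Applications to PDE* (1983), Ch. 5 §5.1. [`Pazy1983`]
-/

noncomputable section

open MeasureTheory Set Filter Function TopologicalSpace UnitAddTorus
open scoped ENNReal NNReal InnerProductSpace Topology

namespace Literature.Analysis.FluidPDE

namespace Torus

variable {d : Type*} [Fintype d] [DecidableEq d]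

omit [DecidableEq d] in
/-- The dissipation of an `L²(μ_T)` gradient against a constant tensor is integrable on `(0,T) × T^d`, hence
in time. [cite: LionsMagenes1972, Chap. 3 §4.4] -/
private theorem integrableOn_dissipation_const_E1 {T : ℝ} (𝔸 : Visc4 d) {G : ℝ → d → UnitAddTorus d → EuclideanSpace ℝ d}
    (hG2 : ∀ c, MemLp (uncurry (G · c)) 2 (((volume : Measure ℝ).restrict (Ioo 0 T)).prod volume)) :
    IntegrableOn (fun τ => ∫ x, ∑ l, ∑ i, ∑ c, ∑ e, 𝔸 i c l e * (G τ c x) i * (G τ e x) l) (Ioo 0 T) := by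
  have hH : Integrable (fun p : ℝ × UnitAddTorus d => ∑ l, ∑ i, ∑ c, ∑ e, 𝔸 i c l e * (G p.1 c p.2) i * (G p.1 e p.2) l)
      (((volume : Measure ℝ).restrict (Ioo 0 T)).prod volume) := by
    refine integrable_finsetSum _ fun l _ => integrable_finsetSum _ fun i _ =>
      integrable_finsetSum _ fun c _ => integrable_finsetSum _ fun e _ => ?_
    refine Integrable.mono' (((hG2 c).norm.integrable_mul (hG2 e).norm).const_mul |𝔸 i c l e|)
      ((aestronglyMeasurable_const.mul
        ((PiLp.continuous_apply 2 _ i).comp_aestronglyMeasurable (hG2 c).1)).mul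
        ((PiLp.continuous_apply 2 _ l).comp_aestronglyMeasurable (hG2 e).1)) (ae_of_all _ fun p => ?_)
    rw [Real.norm_eq_abs, abs_mul, abs_mul]
    show |𝔸 i c l e| * |(G p.1 c p.2) i| * |(G p.1 e p.2) l| ≤ |𝔸 i c l e| * (‖G p.1 c p.2‖ * ‖G p.1 e p.2‖)
    rw [mul_assoc]
    exact mul_le_mul_of_nonneg_left (mul_le_mul (FunctionSpaces.Torus.abs_apply_le_norm (G p.1 c p.2) i)
      (FunctionSpaces.Torus.abs_apply_le_norm (G p.1 e p.2) l) (abs_nonneg _) (norm_nonneg _)) (abs_nonneg _)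
  exact hH.integral_prod_left

section Main

variable {T : ℝ} {𝔸 : Visc4 d} {lo hi : ℝ} {b : ℝ → UnitAddTorus d → EuclideanSpace ℝ d}
  {U : ℝ → ℝ → (Lp (EuclideanSpace ℝ d) 2 (volume : Measure (UnitAddTorus d)) →L[ℝ]
    Lp (EuclideanSpace ℝ d) 2 (volume : Measure (UnitAddTorus d)))}

set_option maxHeartbeats 800000 in
/-- **Energy EQUALITY of the propagator at every time.** For `IsPropagator T b 𝔸 U` with `NearIso 𝔸 lo hi`,
`lo > 0`, `b ∈ L^∞((0,T) × T^d)` weakly divergence free for a.e. `t`, a base time `0 ≤ s < T` and a weakly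
divergence-free `y ∈ L²`: there are a weak solution `w` on `(0, T − s)` from `y` along `τ ↦ b(s + τ)` and a weak
space gradient `G` of it in `L²(μ_{T−s})` with, for EVERY `t ∈ [s, T)`,
`‖U s t y‖² = ‖y‖² − 2 ∫_{(0,t−s]} ∫ Σ_{l,i,c,e} 𝔸_{icle} (G τ c x)_i (G τ e x)_l dx dτ`.
[cite: LionsMagenes1972, Chap. 3 §4.4 (4.20)] [cite: Temam1984, Ch. III §1 Thm. 1.1] -/
theorem IsPropagator.exists_norm_sq_eq (hU : IsPropagator T b 𝔸 U) (h𝔸 : NearIso 𝔸 lo hi) (hlo : 0 < lo)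
    (hb : MemLp (FunctionSpaces.Torus.stLift b) ∞ (volume.restrict (Ioo 0 T ×ˢ univ)))
    (hbdiv : ∀ᵐ t ∂(volume.restrict (Ioo 0 T)), FunctionSpaces.Torus.IsWeaklyDivFree (b t))
    {s : ℝ} (hs : 0 ≤ s) (hsT : s < T)
    (y : Lp (EuclideanSpace ℝ d) 2 (volume : Measure (UnitAddTorus d)))
    (hy : FunctionSpaces.Torus.IsWeaklyDivFree (y : UnitAddTorus d → EuclideanSpace ℝ d)) :
    ∃ (w : ℝ → UnitAddTorus d → EuclideanSpace ℝ d) (G : ℝ → d → UnitAddTorus d → EuclideanSpace ℝ d),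
      IsWeakTensorPassiveVectorOn 0 (T - s) 𝔸 (fun τ => b (s + τ)) (y : UnitAddTorus d → EuclideanSpace ℝ d) w ∧
      (∀ c, MemLp (uncurry (G · c)) 2 (((volume : Measure ℝ).restrict (Ioo 0 (T - s))).prod volume)) ∧
      (∀ᵐ τ ∂(volume.restrict (Ioo 0 (T - s))), ∀ c, FunctionSpaces.Torus.HasWeakPartialDeriv c (w τ) (G τ c)) ∧
      ∀ t ∈ Ico s T, ‖U s t y‖ ^ 2 = ‖y‖ ^ 2 -
        2 * ∫ τ in Ioc 0 (t - s), ∫ x, ∑ l, ∑ i, ∑ c, ∑ e, 𝔸 i c l e * (G τ c x) i * (G τ e x) l := by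
  have hTs : 0 < T - s := sub_pos.2 hsT
  have hym : MemLp (y : UnitAddTorus d → EuclideanSpace ℝ d) 2 volume := Lp.memLp y
  -- the shifted carrier
  have hb' := memLp_top_stLift_shift_window (T := T) hb hs
  have hbdiv' : ∀ᵐ τ ∂(volume.restrict (Ioo 0 (T - s))), FunctionSpaces.Torus.IsWeaklyDivFree (b (s + τ)) :=
    ae_restrict_Ioo_comp_add_left (P := fun t => FunctionSpaces.Torus.IsWeaklyDivFree (b t)) hbdiv hs (by linarith)
  obtain ⟨M, hM, hbM⟩ := ae_norm_le_prod_of_memLp_top_stLift hb'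
  -- a weak solution on the window (Lions) and its energy equality at a.e. time
  obtain ⟨w, hsol⟩ := exists_isWeakTensorPassiveVectorOn hTs h𝔸 hlo hb' hbdiv' hym hy
  obtain ⟨G, hG2, hGw, hE⟩ := hsol.ae_integral_norm_sq_eq h𝔸 hlo hb' hM hbM hym hy
  refine ⟨w, G, hsol, hG2, hGw, ?_⟩
  -- the representation of `U` by `w`
  have hrepr := hU.repr s hs hsT _ hym hy w hsol
  have hyLp : hym.toLp (y : UnitAddTorus d → EuclideanSpace ℝ d) = y := Lp.toLp_coeFn y hym
  have hE0 : (∫ x, ‖(y : UnitAddTorus d → EuclideanSpace ℝ d) x‖ ^ 2) = ‖y‖ ^ 2 :=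
    (norm_sq_eq_integral_norm_sq y).symm
  -- the right-hand side `R` and its continuity
  set D : ℝ → ℝ := fun τ => ∫ x, ∑ l, ∑ i, ∑ c, ∑ e, 𝔸 i c l e * (G τ c x) i * (G τ e x) l with hDdef
  have hDI : IntegrableOn D (Ioo 0 (T - s)) := integrableOn_dissipation_const_E1 𝔸 hG2
  set R : ℝ → ℝ := fun r => ‖y‖ ^ 2 - 2 * ∫ τ in Ioc 0 r, D τ with hRdef
  have hRc : ContinuousOn R (Icc 0 (T - s)) := by
    have hprim : ContinuousOn (fun r => ∫ τ in Ioc 0 r, D τ) (Icc 0 (T - s)) :=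
      intervalIntegral.continuousOn_primitive ((integrableOn_Icc_iff_integrableOn_Ioo (by simp) (by simp)).2 hDI)
    exact continuousOn_const.sub (continuousOn_const.mul hprim)
  -- a.e. `r ∈ (0, T − s)`: `‖U s (s + r) y‖² = R r`
  have hae : ∀ᵐ r ∂(volume.restrict (Ioo 0 (T - s))), ‖U s (s + r) y‖ ^ 2 = R r := by
    filter_upwards [hE, hrepr] with r hr hrep
    obtain ⟨hm, he⟩ := hrep
    rw [hyLp] at he
    rw [← he, norm_toLp_sq_eq_integral hm, hr, hE0]
  -- `R ≥ 0` on the closed window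
  have hR0 : ∀ r ∈ Icc 0 (T - s), 0 ≤ R r :=
    le_on_Icc_of_ae_le_of_continuousOn₂ hTs continuousOn_const hRc (hae.mono fun r hr => by rw [← hr]; positivity)
  intro t ht
  set r₀ : ℝ := t - s with hr₀def
  have hr₀0 : 0 ≤ r₀ := sub_nonneg.2 ht.1
  have hr₀T : r₀ < T - s := sub_lt_sub_right ht.2 s
  have hst : s + r₀ = t := by rw [hr₀def]; ring
  set z := U s t y with hzdef
  show ‖z‖ ^ 2 = R r₀
  -- (≥): contraction + cocycle for `r > r₀`, right limit of `R`
  have hge : R r₀ ≤ ‖z‖ ^ 2 := by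
    have hsub : Ioo r₀ (T - s) ⊆ Ioo 0 (T - s) := Ioo_subset_Ioo hr₀0 le_rfl
    have hae' : ∀ᵐ r ∂(volume.restrict (Ioo r₀ (T - s))), R r ≤ ‖z‖ ^ 2 := by
      filter_upwards [ae_restrict_of_ae_restrict_of_subset hsub hae, ae_restrict_mem measurableSet_Ioo] with r hr hrI
      rw [← hr]
      have hcomp : U t (s + r) (U s t y) = U s (s + r) y :=
        hU.comp s t (s + r) hs ht.1 (by rw [← hst]; linarith [hrI.1]) (by linarith [hrI.2]) y
      rw [← hcomp]
      exact pow_le_pow_left₀ (norm_nonneg _) (hU.norm_le t (s + r) z) 2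
    exact le_on_Icc_of_ae_le_of_continuousOn₂ hr₀T (hRc.mono (Icc_subset_Icc hr₀0 le_rfl)) continuousOn_const hae'
      r₀ ⟨le_rfl, hr₀T.le⟩
  -- (≤): weak continuity tested against `z` (lower semicontinuity of the norm)
  have hle : ‖z‖ ^ 2 ≤ R r₀ := by
    set f : ℝ → ℝ := fun r => ⟪U s (s + r) y, z⟫_ℝ with hfdef
    set g : ℝ → ℝ := fun r => Real.sqrt (R r) * ‖z‖ with hgdef
    have hfc : ContinuousOn f (Icc 0 (T - s)) := by
      have hc := hU.continuousOn s hs hsT.le y z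
      refine hc.comp (continuous_const.add continuous_id).continuousOn ?_
      intro r hr
      exact ⟨by linarith [hr.1], by linarith [hr.2]⟩
    have hgc : ContinuousOn g (Icc 0 (T - s)) := (Real.continuous_sqrt.comp_continuousOn hRc).mul continuousOn_const
    have hfg : ∀ᵐ r ∂(volume.restrict (Ioo 0 (T - s))), f r ≤ g r := by
      filter_upwards [hae] with r hr
      have h1 : f r ≤ ‖U s (s + r) y‖ * ‖z‖ := real_inner_le_norm _ _
      have h2 : ‖U s (s + r) y‖ = Real.sqrt (R r) := by rw [← hr, Real.sqrt_sq (norm_nonneg _)]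
      rw [h2] at h1
      exact h1
    have hend := le_on_Icc_of_ae_le_of_continuousOn₂ hTs hfc hgc hfg r₀ ⟨hr₀0, hr₀T.le⟩
    have hf0 : f r₀ = ‖z‖ ^ 2 := by
      simp only [hfdef, hst]
      exact real_inner_self_eq_norm_sq z
    rw [hf0] at hend
    -- `‖z‖² ≤ √R ‖z‖` gives `‖z‖ ≤ √R`, hence `‖z‖² ≤ R`
    have hRr₀ : 0 ≤ R r₀ := hR0 r₀ ⟨hr₀0, hr₀T.le⟩
    by_cases hz : ‖z‖ = 0
    · rw [hz]; simpa using hRr₀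
    · have hzpos : 0 < ‖z‖ := lt_of_le_of_ne (norm_nonneg _) (Ne.symm hz)
      have h3 : ‖z‖ ≤ Real.sqrt (R r₀) := by
        have : ‖z‖ * ‖z‖ ≤ Real.sqrt (R r₀) * ‖z‖ := by rw [← sq]; exact hend
        exact le_of_mul_le_mul_right this hzpos
      calc ‖z‖ ^ 2 ≤ Real.sqrt (R r₀) ^ 2 := pow_le_pow_left₀ (norm_nonneg _) h3 2
        _ = R r₀ := Real.sq_sqrt hRr₀
  exact le_antisymm hle hge

end Main

end Torus

end Literature.Analysis.FluidPDE

end
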